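import Mathlib.LinearAlgebra.Matrix.GeneralLinearGroup.Defs
import Mathlib.LinearAlgebra.Matrix.SpecialLinearGroup
import Mathlib.LinearAlgebra.Matrix.Notation
import Mathlib.Data.Matrix.Basis
import Mathlib.Data.ZMod.Basic
import Mathlib.Tactic.FinCases
import Mathlib.Tactic.NormNum
import Summits.BirchSwinnertonDyer.Rank1Residual.X11b.Three.ImageSpan
import HarnessLib

/-!
# X11b at `p = 3` (cell `bsd-stepL`, seat `bsd-stepL-koly`): counting UNIPOTENT-ADMISSIBLE Frobenius
# classes in `GL₂(𝔽₃)`, and `SL₂(R)` spans `M₂(R)`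

HONEST FRAMING (cell `bsd-stepL`, FULL-BSD rank ≤ 1 programme D-0033 tranche 1a; memo
`run/shared/lean/pub/bsd-stepL/koly/MEMO-v2.md` §3, Lemmas U3 / U8): finite, elementary THEOREMS about
`2 × 2` matrices over `𝔽₃` and over a commutative ring. No named fact, no `sorry`, nothing about
elliptic curves is asserted, nothing is booked. Companion of `Three/UnipotentAdmissible.lean`
(Lemmas U1–U5).

## What is counted and why (memo §3, Lemma U3 — the Čebotarev supply with sign at `p = 3`)

A prime `q ∤ 3 N d_K`, inert in `K`, is `(3,1)`-unipotent-admissible for `(E, K)` with sign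
`δ ∈ {±1}` iff `ρ̄_{E,3}(Frob_q) = δ·u` with `u` unipotent, `u ≠ 1` (then `q ≡ det(δu) = 1 (mod 3)`
and `a_q ≡ 2δ`). Under `Surj(3)` and `K ∩ ℚ(E[3]) = ℚ` the Frobenius of `q` in
`Gal(K(E[3])/ℚ) = Gal(K/ℚ) × GL₂(𝔽₃)` is equidistributed (Čebotarev), so the density of
u-admissible primes of sign `δ` among all primes is `(1/2)·#{g ∈ GL₂(𝔽₃) : (g − δ)² = 0, g ≠ δ}/48`.
Below: each sign contributes `8` matrices (`card_filter_unipotent_ne_one`,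
`card_filter_neg_unipotent_ne_neg_one`), all of determinant `1` (`det_eq_one_of_sq_sub_one_eq_zero`),
and `#GL₂(𝔽₃) = 48` (`card_filter_det_ne_zero`): density `8/96 = 1/12` per sign, `1/6` in total
(memo U3; observed `16` u-admissible vs `1` scalar among the inert level-raising-type `q < 600` for
`57a1`, `K = ℚ(√−2)`, kit j236356).

## `SL₂(R)` spans `M₂(R)` (memo §4.2, the Taylor–Wiles hypothesis at `p = 3`)

`span_range_specialLinearGroup_eq_top`: for every commutative ring `R`, the `R`-span of
`SL₂(R) ⊂ M₂(R)` is everything (`E₀₁ = T − 1`, `E₁₀ = T′ − 1`, `E₀₀ = TT′ − T − T′ + 1`,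
`E₁₁ = 1 − E₀₀` with `T = [[1,1],[0,1]]`, `T′ = [[1,0],[1,1]]`). Use: under `Surj(3)` the image of
`G_{ℚ(√−3)} = G_{ℚ(ζ₃)}` is `SL₂(𝔽₃)` (the kernel of `det = ε̄`), whose `𝔽₃`-span is `M₂(𝔽₃)`;
a representation whose image spans the full matrix algebra is ABSOLUTELY IRREDUCIBLE (a proper
invariant subspace after any extension of scalars would be invariant under the span). This is the
hypothesis "ρ̄|_{G_{F(ζ_p)}} absolutely irreducible" of Gee, Math. Ann. 350 (2011) §3 (p > 2) and of
Kisin's potentially Barsotti–Tate modularity lifting, used at `p = 3` in the level-raising step of the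
memo (SZ14 Lemma 5.4 repaired, memo §4.2).

## References

* M. Bertolini, H. Darmon, Ann. of Math. 162 (2005) p. 18, Thm. 3.2 p. 22. [BertoliniDarmon2005]
* W. Zhang, Camb. J. Math. 2 (2014), Lemma 7.3. [WZhang2014]
* T. Gee, *Automorphic lifts of prescribed types*, Math. Ann. 350 (2011) 107–144, §3.1 (cited in
  prose; no bib key needed — nothing from it is asserted here).
-/

namespace Summit.BirchSwinnertonDyer.Rank1Residual.X11b.Three.UAdm

open Matrix

/-! ### Counting unipotent-admissible Frobenius classes in `M₂(𝔽₃)` -/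

section Count

/-- A `2 × 2` matrix `g` over `𝔽₃` with `(g − 1)² = 0` has determinant `1` (it is `1 +` a nilpotent):
in particular the u-admissible Frobenius images of sign `+1` lie in `SL₂(𝔽₃)`, consistent with
`q ≡ 1 (mod 3)`. Finite check over the 81 matrices. [folklore] -/
theorem det_eq_one_of_sq_sub_one_eq_zero :
    ∀ g : Matrix (Fin 2) (Fin 2) (ZMod 3), (g - 1) * (g - 1) = 0 → g.det = 1 := by
  decide

/-- Likewise `(g + 1)² = 0` forces `det g = 1` (sign `δ = −1`: `g = −u`, `det(−u) = det u = 1`).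
[folklore] -/
theorem det_eq_one_of_sq_add_one_eq_zero :
    ∀ g : Matrix (Fin 2) (Fin 2) (ZMod 3), (g + 1) * (g + 1) = 0 → g.det = 1 := by
  decide

/-- **Exactly 8 non-trivial unipotent matrices in `M₂(𝔽₃)`** (`(g − 1)² = 0`, `g ≠ 1`): the
u-admissible Frobenius images of sign `+1`. [folklore] -/
theorem card_filter_unipotent_ne_one :
    (Finset.univ.filter
      (fun g : Matrix (Fin 2) (Fin 2) (ZMod 3) => (g - 1) * (g - 1) = 0 ∧ g ≠ 1)).card = 8 := by
  decide

/-- **Exactly 8 matrices `g = −u`, `u ≠ 1` unipotent, in `M₂(𝔽₃)`** (`(g + 1)² = 0`, `g ≠ −1`):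
the u-admissible Frobenius images of sign `−1`. [folklore] -/
theorem card_filter_neg_unipotent_ne_neg_one :
    (Finset.univ.filter
      (fun g : Matrix (Fin 2) (Fin 2) (ZMod 3) => (g + 1) * (g + 1) = 0 ∧ g ≠ -1)).card = 8 := by
  decide

/-- The two sign classes are disjoint (no `g` has both `(g−1)² = 0`, `g ≠ 1` and `(g+1)² = 0`):
so `16` u-admissible Frobenius images in all. [folklore] -/
theorem card_filter_unipotentAdmissible :
    (Finset.univ.filter
      (fun g : Matrix (Fin 2) (Fin 2) (ZMod 3) =>
        ((g - 1) * (g - 1) = 0 ∧ g ≠ 1) ∨ ((g + 1) * (g + 1) = 0 ∧ g ≠ -1))).card = 16 := by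
  decide

/-- **`#GL₂(𝔽₃) = 48`**, counted as the matrices of non-zero determinant. With the two counts
above: the u-admissible classes are `16/48 = 1/3` of `GL₂(𝔽₃)`, hence (times `1/2` for "inert in
`K`") density `1/6` of all primes, `1/12` for each sign (memo U3). [folklore] -/
theorem card_filter_det_ne_zero :
    (Finset.univ.filter (fun g : Matrix (Fin 2) (Fin 2) (ZMod 3) => g.det ≠ 0)).card = 48 := by
  decide

/-- The scalar classes `±1` excluded by u-admissibility are exactly `2` of the `18` matrices of
`GL₂(𝔽₃)` with `(g − 1)² = 0 ∨ (g + 1)² = 0`: `18 = 16 + 2`. [folklore] -/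
theorem card_filter_sq_sub_or_add_eq_zero :
    (Finset.univ.filter
      (fun g : Matrix (Fin 2) (Fin 2) (ZMod 3) =>
        (g - 1) * (g - 1) = 0 ∨ (g + 1) * (g + 1) = 0)).card = 18 := by
  decide

end Count

/-! ### `SL₂(R)` spans `M₂(R)` -/

section Span

variable {R : Type*} [CommRing R]

/-- The four elementary matrices are `ℤ`-combinations of `1`, `T = [[1,1],[0,1]]`,
`T′ = [[1,0],[1,1]]` and `TT′ = [[2,1],[1,1]]`, all of determinant `1`:
`E₀₁ = T − 1`, `E₁₀ = T′ − 1`, `E₀₀ = TT′ − T − T′ + 1`, `E₁₁ = 1 − E₀₀`. [folklore] -/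
theorem single_mem_of_four_mem_sl {N : Submodule R (Matrix (Fin 2) (Fin 2) R)}
    (h1 : (1 : Matrix (Fin 2) (Fin 2) R) ∈ N) (hT : !![1, 1; 0, 1] ∈ N)
    (hT' : !![1, 0; 1, 1] ∈ N) (hP : !![2, 1; 1, 1] ∈ N) (i j : Fin 2) :
    Matrix.single i j (1 : R) ∈ N := by
  have e01 : Matrix.single 0 1 (1 : R) = !![1, 1; 0, 1] - 1 := by
    ext a b; fin_cases a <;> fin_cases b <;> simp [Matrix.one_fin_two]
  have e10 : Matrix.single 1 0 (1 : R) = !![1, 0; 1, 1] - 1 := by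
    ext a b; fin_cases a <;> fin_cases b <;> simp [Matrix.one_fin_two]
  have e00 : Matrix.single 0 0 (1 : R) = !![2, 1; 1, 1] - !![1, 1; 0, 1] - !![1, 0; 1, 1] + 1 := by
    ext a b; fin_cases a <;> fin_cases b <;> norm_num [Matrix.one_fin_two]
  have e11 : Matrix.single 1 1 (1 : R) =
      1 - (!![2, 1; 1, 1] - !![1, 1; 0, 1] - !![1, 0; 1, 1] + 1) := by
    ext a b; fin_cases a <;> fin_cases b <;> norm_num [Matrix.one_fin_two]
  have h00 : Matrix.single 0 0 (1 : R) ∈ N := by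
    rw [e00]; exact N.add_mem (N.sub_mem (N.sub_mem hP hT) hT') h1
  have h01 : Matrix.single 0 1 (1 : R) ∈ N := by rw [e01]; exact N.sub_mem hT h1
  have h10 : Matrix.single 1 0 (1 : R) ∈ N := by rw [e10]; exact N.sub_mem hT' h1
  have h11 : Matrix.single 1 1 (1 : R) ∈ N := by
    rw [e11]; exact N.sub_mem h1 (N.add_mem (N.sub_mem (N.sub_mem hP hT) hT') h1)
  fin_cases i <;> fin_cases j
  · exact h00
  · exact h01
  · exact h10
  · exact h11

/-- **`SL₂(R)` spans `M₂(R)`** as an `R`-module, for every commutative ring `R` (no Burnside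
theorem, no hypothesis on `R`). Use in the memo (§4.2): under `Surj(3)`, `ρ̄_{E,3}(G_{ℚ(ζ₃)}) =
SL₂(𝔽₃)` spans `M₂(𝔽₃)`, so `ρ̄|_{G_{ℚ(ζ₃)}}` is absolutely irreducible — the Taylor–Wiles
hypothesis of Gee 2011 §3 / Kisin at `p = 3`. [folklore] -/
theorem span_range_specialLinearGroup_eq_top :
    Submodule.span R
      (Set.range ((↑) : Matrix.SpecialLinearGroup (Fin 2) R → Matrix (Fin 2) (Fin 2) R)) = ⊤ := by
  apply ImageSpan.submodule_eq_top_of_single_mem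
  apply single_mem_of_four_mem_sl
  · exact Submodule.subset_span ⟨(1 : Matrix.SpecialLinearGroup (Fin 2) R), rfl⟩
  · refine Submodule.subset_span ⟨⟨!![1, 1; 0, 1], ?_⟩, rfl⟩
    simp [Matrix.det_fin_two]
  · refine Submodule.subset_span ⟨⟨!![1, 0; 1, 1], ?_⟩, rfl⟩
    simp [Matrix.det_fin_two]
  · refine Submodule.subset_span ⟨⟨!![2, 1; 1, 1], ?_⟩, rfl⟩
    simp [Matrix.det_fin_two]; norm_num

/-- Consequence used for absolute irreducibility: a submodule of `R²`... stated at the level that is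
actually consumed — **no proper non-zero `R`-submodule of `Fin 2 → R` is stable under all of
`SL₂(R)` when `R` is a field**: if `W` is stable under every `g ∈ SL₂(R)` then it is stable under
every matrix (they are `R`-combinations of elements of `SL₂(R)`), in particular under `E₀₁` and
`E₁₀`, which forces `W = ⊥` or `W = ⊤`. Over an extension field `R ⊇ 𝔽₃` this is the absolute
irreducibility of the standard representation of `SL₂(𝔽₃)` (apply it to the `R`-points, which
contain the images of `T`, `T′`). [folklore] -/
theorem eq_bot_or_eq_top_of_forall_sl_mulVec_mem {F : Type*} [Field F] (W : Submodule F (Fin 2 → F))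
    (hW : ∀ g : Matrix.SpecialLinearGroup (Fin 2) F, ∀ v ∈ W, (g : Matrix (Fin 2) (Fin 2) F) *ᵥ v ∈ W) :
    W = ⊥ ∨ W = ⊤ := by
  classical
  -- stability under every matrix, by the span statement
  have hall : ∀ A : Matrix (Fin 2) (Fin 2) F, ∀ v ∈ W, A *ᵥ v ∈ W := by
    intro A v hv
    have hA : A ∈ Submodule.span F
        (Set.range ((↑) : Matrix.SpecialLinearGroup (Fin 2) F → Matrix (Fin 2) (Fin 2) F)) := by
      rw [span_range_specialLinearGroup_eq_top]; trivial
    induction hA using Submodule.span_induction with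
    | mem x hx => obtain ⟨g, rfl⟩ := hx; exact hW g v hv
    | zero => simp
    | add x y _ _ hx hy => rw [Matrix.add_mulVec]; exact W.add_mem hx hy
    | smul a x _ hx => rw [Matrix.smul_mulVec]; exact W.smul_mem a hx
  by_cases h : W = ⊥
  · exact Or.inl h
  · right
    obtain ⟨v, hvW, hv0⟩ := (Submodule.ne_bot_iff W).mp h
    -- some coordinate of `v` is non-zero; move it to both coordinates with elementary matrices
    have hcoord : ∃ i, v i ≠ 0 := by
      by_contra hc; push Not at hc; exact hv0 (funext hc)
    obtain ⟨i, hi⟩ := hcoord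
    have hsingle : ∀ j, Pi.single j (1 : F) ∈ W := by
      intro j
      have hmem : Matrix.single j i (v i)⁻¹ *ᵥ v ∈ W := hall _ v hvW
      have hcalc : Matrix.single j i (v i)⁻¹ *ᵥ v = Pi.single j (1 : F) := by
        rw [Matrix.single_mulVec, inv_mul_cancel₀ hi]
        ext a
        by_cases hja : a = j
        · subst hja; simp
        · simp [Function.update_of_ne hja, Pi.single_eq_of_ne hja]
      rw [hcalc] at hmem; exact hmem
    rw [eq_top_iff]
    rintro w -
    have hw : w = ∑ j, w j • Pi.single j (1 : F) := by
      ext a; simp [Finset.sum_apply, Pi.single_apply]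
    rw [hw]
    exact W.sum_mem fun j _ => W.smul_mem _ (hsingle j)

end Span

end Summit.BirchSwinnertonDyer.Rank1Residual.X11b.Three.UAdm
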